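import Literature.NumberTheory.LFunctions.ConreyIwaniec2002Prop81MeanSquares
import Literature.NumberTheory.LFunctions.ConreyIwaniec2002AFE
import Literature.NumberTheory.LFunctions.ConreyIwaniec2002AFEResidualBound
import Literature.NumberTheory.LFunctions.DivisorSquareWeightedSum
import Literature.NumberTheory.LFunctions.ConreyIwaniec2002MollifierMeanSquare
import Literature.NumberTheory.LFunctions.ConreyIwaniec2002MeanValues
import HarnessLib

/-!
# Conrey–Iwaniec (2002), §§7–8: the discrete mean square of `L(½+it,ψ)` itself over a dyadic point set

B. Conrey, H. Iwaniec, *Spacing of zeros of Hecke L-functions and the class number problem*,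
Acta Arith. 103 (2002) [held text `paper:arxiv-math_0111012`, p0017–p0019].

For `K = ℚ(√−q)` (`q` odd `> 4`), `ψ ∈ Ĉℓ(K)` and a `1`-spaced set of points `s = ½ + it`,
`T < t ≤ 2T`, the printed §8 (p. 19, the sums `A₃ = A₃₁ + A₃₂ + A₃₃` of (8.7)) bounds the discrete
mean square of the main sum `A(s) = Σ λ(n)n^{−s}V_s(n/Q)` of the approximate functional equation
(7.12); with `L(s) = A(s) + ψ([𝔡])X(s)Ā(s) + R(s)` (Proposition 7.1, tree
`classGroupLFunction_eq_afe_conj`), `|X(s)| = 1`, this is a bound for the DISCRETE MEAN SQUARE OF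
`L(½+it,ψ)` ITSELF:

  `Σ_{t ∈ S} |L(½+it,ψ)|² ≤ C·(T(log q)^7 + Tℒ(T)(log T)^4)`   (`q^66 ≤ T`, `e^{(log q)²} ≤ T`),

from the typed Proposition 6.4 (`conreyIwaniec2002_proposition64`, binder `h64`) alone. PROVED
HERE (`ConreyIwaniec2002.sum_norm_classGroupLFunction_sq_le`) from the tree's Proposition 8.1
machinery: `main_meanSquares` (ii) (`(log T)² Σ|A(s) − N(s)|² ≤ C·(…)`, line
`prop81-afe-plancherel`, S6c) with the divisor second moment `divisorSq_weighted_tsum_le` (S6b),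
the discrete mean square of `N(s) = Σ_{n≤q⁴} λ(n)n^{−s}` (`sum_norm_shortLSum_sq_le`, the twin of
the tree's `sum_norm_shortInvSum_sq_le`: "Lemma 5.3" = `Gallagher.discreteMeanValue` and
`|λ(n)| ≤ τ(n)`), and the uniform bound for the residual `R` (`norm_afeR_one_le`; `R = 0` unless
`ψ = 1`). This is the input through which Proposition 9.1 tolerates FAR companions
(`ConreyIwaniec2002Prop91FarCompanions.lean`). No definition, no named fact.

«The programme SEARCHES and TYPES; no claim about Landau–Siegel zeros, Theorems 1–2 of
arXiv:2211.02515 or a repaired Margin232 until a kernel theorem says so.»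

## References
* [ConreyIwaniec2002] B. Conrey, H. Iwaniec, Acta Arith. 103 (2002) 259–312, arXiv:math/0111012:
  Lemma 5.3, Proposition 7.1 (7.12), §8 (8.7)–(8.9), Proposition 8.1 (8.10).
-/

noncomputable section

open scoped NumberField
open Complex

namespace Literature.NumberTheory.LFunctions

namespace ConreyIwaniec2002

open NumberField

/-! ### The discrete mean square of `N(s) = Σ_{n ≤ q⁴} λ(n) n^{−s}` -/

/-- **The discrete mean square of the short `L`-sum `N(s)` (8.8).** For `1`-spaced points
`s = ½ + it`, `t ∈ S ⊂ (T, 2T]`, `T ≥ q⁴`: `Σ_{t∈S} |N(½+it)|² ≤ C·T(log q)^5`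
("Lemma 5.3" with `|λ(n)| ≤ τ(n,χ) ≤ d(n)` and `Σ_{n≤q⁴} d(n)²/n ≤ (1 + 4 log q)⁴`), absolute `C`;
the twin of the tree's `sum_norm_shortInvSum_sq_le` for `M(s)`.
[cite: ConreyIwaniec2002, Lemma 5.3 (5.4); §8 (8.8)] -/
theorem sum_norm_shortLSum_sq_le :
    ∃ C : ℝ, 0 < C ∧
    ∀ (q : ℕ) [NeZero q], 4 < q → Odd q → ∀ χ : DirichletCharacter ℂ q,
      χ.IsPrimitive → χ.IsQuadratic → χ.Odd →
        ∀ (K : Type) [Field K] [NumberField K],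
          Module.finrank ℚ K = 2 → NumberField.discr K = -(q : ℤ) →
            ∀ (ψ : ClassGroup (𝓞 K) →* ℂˣ) (T : ℝ) (S : Finset ℝ),
              (q : ℝ) ^ (4 : ℕ) ≤ T → IsDyadicPointSet S T →
                ∑ t ∈ S, ‖shortLSum K ψ q (1 / 2 + t * I)‖ ^ 2 ≤
                  C * (T * Real.log q ^ (5 : ℕ)) := by
  refine ⟨100000, by norm_num, fun q _ hq _ χ hprim hquad hodd K _ _ h2 hdisc ψ T S hT hS => ?_⟩
  classical
  have hq0 : 0 < q := by omega
  have hq5 : (5 : ℝ) ≤ q := by exact_mod_cast hq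
  have hℓ1 : 1 ≤ Real.log q := by
    rw [Real.le_log_iff_exp_le (by linarith)]
    exact Real.exp_one_lt_d9.le.trans (by linarith)
  set ℓ : ℝ := Real.log q with hℓdef
  set N : ℕ := q ^ 4 with hNdef
  have hNpos : 0 < N := pow_pos hq0 4
  have hNreal : (N : ℝ) = (q : ℝ) ^ (4 : ℕ) := by rw [hNdef]; push_cast; ring
  have hT1 : (1 : ℝ) ≤ T := le_trans (by rw [← hNreal]; exact_mod_cast hNpos) hT
  have hT0 : 0 < T := by linarith
  have hlogN : Real.log N = 4 * ℓ := by rw [hNreal, Real.log_pow]; push_cast; ring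
  -- the coefficients `a(n) = λ(n) n^{-1/2}`
  set ν := classGroupCharIdealHom ψ with hνdef
  set a : ℕ → ℂ := fun m => twistCount K ν m * (m : ℂ) ^ (-(1 / 2 : ℂ)) with hadef
  -- `N(½+it) = Σ a(n) n^{-it}`
  have hM : ∀ t : ℝ, shortLSum K ψ q (1 / 2 + t * I) =
      ∑ m ∈ Finset.Icc 1 N, a m * (m : ℂ) ^ (-((t : ℂ) * I)) := by
    intro t
    unfold shortLSum
    refine Finset.sum_congr rfl fun m hm => ?_
    rw [Finset.mem_Icc] at hm
    have hm0 : (m : ℂ) ≠ 0 := by exact_mod_cast (by omega : m ≠ 0)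
    rw [hadef, neg_add, Complex.cpow_add _ _ hm0]
    simp only
    ring
  -- the discrete mean value theorem on `[−2T, 2T]`, `δ = 1`
  have hmem : ∀ t ∈ S, |t| ≤ 2 * T := by
    intro t ht
    have h := hS.mem_bounds ht
    rw [abs_of_pos (by linarith [h.1])]
    exact h.2
  have hsep : ∀ t ∈ S, ∀ t' ∈ S, t ≠ t' → (1 : ℝ) ≤ |t - t'| := fun t ht t' ht' h => hS.2 t ht t' ht' h
  have hG := Gallagher.discreteMeanValue a N (by positivity : (0 : ℝ) < 2 * T) one_pos S hmem hsep
  simp_rw [← hM] at hG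
  -- the coefficient sum `Σ |a(n)|² ≤ Σ d(n)²/n ≤ (1 + 4ℓ)^4`
  have hcoef : ∑ m ∈ Finset.Icc 1 N, ‖a m‖ ^ 2 ≤ (1 + 4 * ℓ) ^ 4 := by
    calc ∑ m ∈ Finset.Icc 1 N, ‖a m‖ ^ 2
        ≤ ∑ m ∈ Finset.Icc 1 N, (m.divisors.card : ℝ) ^ 2 / m := by
          refine Finset.sum_le_sum fun m hm => ?_
          rw [Finset.mem_Icc] at hm
          have hm0 : m ≠ 0 := by omega
          have hmpos : (0 : ℝ) < m := by exact_mod_cast (by omega : 0 < m)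
          have hnorm : ‖a m‖ = ‖twistCount K ν m‖ * (m : ℝ) ^ (-(1 / 2 : ℝ)) := by
            rw [hadef]
            simp only [norm_mul]
            congr 1
            rw [show (-(1 / 2 : ℂ)) = ((-(1 / 2 : ℝ) : ℝ) : ℂ) by push_cast; ring,
              Complex.norm_natCast_cpow_of_pos (by omega), Complex.ofReal_re]
          have hlam : ‖twistCount K ν m‖ ≤ (m.divisors.card : ℝ) :=
            (norm_twistCount_le (norm_classGroupCharIdealHom_le ψ) m).trans
              (idealNormCount_le_card_divisors_of_quadratic hprim hquad hodd K h2 hdisc hm0)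
          rw [hnorm, mul_pow]
          have hpow : ((m : ℝ) ^ (-(1 / 2 : ℝ))) ^ 2 = 1 / m := by
            rw [← Real.rpow_natCast, ← Real.rpow_mul hmpos.le]
            norm_num
            rw [Real.rpow_neg_one]
          rw [hpow, ← div_eq_mul_one_div]
          gcongr
      _ ≤ (1 + Real.log N) ^ 4 := ZetaM4D.sum_card_divisors_sq_div_le N
      _ = (1 + 4 * ℓ) ^ 4 := by rw [hlogN]
  -- assemble: `(5(2T + 1/2) + 18 q⁴)(1 + 4ℓ) (1 + 4ℓ)^4 ≤ 10⁵ T ℓ^5`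
  have hN_le : (N : ℝ) ≤ T := by rw [hNreal]; exact hT
  have hfac1 : 5 * (2 * T + 1 / 2) + 18 * (N : ℝ) ≤ 31 * T := by nlinarith
  have hfac2 : (1 : ℝ)⁻¹ + Real.log N ≤ 5 * ℓ := by rw [hlogN, inv_one]; linarith
  have hfac3 : (1 + 4 * ℓ) ^ 4 ≤ (5 * ℓ) ^ 4 := by
    apply pow_le_pow_left₀ (by positivity); linarith
  calc ∑ t ∈ S, ‖shortLSum K ψ q (1 / 2 + t * I)‖ ^ 2
      ≤ (5 * (2 * T + 1 / 2) + 18 * N) * ((1 : ℝ)⁻¹ + Real.log N) *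
          ∑ m ∈ Finset.Icc 1 N, ‖a m‖ ^ 2 := hG
    _ ≤ (31 * T) * (5 * ℓ) * (5 * ℓ) ^ 4 := by
        have h0 : 0 ≤ ∑ m ∈ Finset.Icc 1 N, ‖a m‖ ^ 2 := Finset.sum_nonneg fun _ _ => by positivity
        have h1 : 0 ≤ (1 : ℝ)⁻¹ + Real.log N := by rw [hlogN, inv_one]; positivity
        gcongr
        · exact hcoef.trans hfac3
    _ = 96875 * (T * ℓ ^ 5) := by ring
    _ ≤ 100000 * (T * ℓ ^ 5) := by
        have : 0 ≤ T * ℓ ^ 5 := by positivity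
        nlinarith

/-! ### Pointwise: `|L(½+it)| ≤ 2|A(½+it)| + |R(½+it)|` -/

/-- **`|L(½+it,ψ)| ≤ 2|A(½+it)| + |R(½+it)|`** from Proposition 7.1 on the critical line
(`L = A + ψ([𝔡])X·Ā + R`, `|X(½+it)| = 1`, `|ψ([𝔡])| = 1`).
[cite: ConreyIwaniec2002, Proposition 7.1 (7.12)–(7.13)] -/
theorem norm_classGroupLFunction_le_afe {q : ℕ} (hq : 0 < q) (K : Type) [Field K] [NumberField K]
    (h2 : Module.finrank ℚ K = 2) (hdisc : NumberField.discr K = -(q : ℤ))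
    (ψ : ClassGroup (𝓞 K) →* ℂˣ) (t : ℝ) :
    ‖classGroupLFunction K ψ (1 / 2 + t * I)‖ ≤
      2 * ‖afeA K ψ q (1 / 2 + t * I)‖ + ‖afeR K ψ q (1 / 2 + t * I)‖ := by
  rw [classGroupLFunction_eq_afe_conj (K := K) h2 hdisc ψ t]
  have hX : ‖afeX q (1 / 2 + t * I)‖ = 1 := norm_afeX_half q hq t
  have hψ : ‖(ψ (differentClass K) : ℂ)‖ = 1 := norm_classGroupChar_apply ψ _
  have hc : ‖starRingEnd ℂ (afeA K ψ q (1 / 2 + t * I))‖ = ‖afeA K ψ q (1 / 2 + t * I)‖ :=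
    RCLike.norm_conj _
  calc ‖afeA K ψ q (1 / 2 + t * I) +
          (ψ (differentClass K) : ℂ) * afeX q (1 / 2 + t * I) *
            starRingEnd ℂ (afeA K ψ q (1 / 2 + t * I)) +
          afeR K ψ q (1 / 2 + t * I)‖
      ≤ ‖afeA K ψ q (1 / 2 + t * I)‖ +
          ‖(ψ (differentClass K) : ℂ) * afeX q (1 / 2 + t * I) *
            starRingEnd ℂ (afeA K ψ q (1 / 2 + t * I))‖ +
          ‖afeR K ψ q (1 / 2 + t * I)‖ := norm_add₃_le
    _ = 2 * ‖afeA K ψ q (1 / 2 + t * I)‖ + ‖afeR K ψ q (1 / 2 + t * I)‖ := by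
        rw [norm_mul, norm_mul, hX, hψ, hc]; ring

/-- **The residual is uniformly bounded at the points of §8**: `|R(½+it)| ≤ M` for
`|t| ≥ max(q+1, 4)` (an absolute `M`; `R = 0` unless `ψ = 1`).
[cite: ConreyIwaniec2002, Proposition 7.1 (7.12); §8 (8.10)] -/
theorem norm_afeR_half_le :
    ∃ M : ℝ, 0 < M ∧ ∀ (q : ℕ), 0 < q → ∀ (K : Type) [Field K] [NumberField K],
      Module.finrank ℚ K = 2 → NumberField.discr K = -(q : ℤ) →
        ∀ (ψ : ClassGroup (𝓞 K) →* ℂˣ) (t : ℝ), (q : ℝ) + 1 ≤ |t| → 4 ≤ |t| →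
          ‖afeR K ψ q (1 / 2 + t * I)‖ ≤ M := by
  obtain ⟨M, hM, h⟩ := norm_afeR_one_le
  refine ⟨M, hM, fun q hq K _ _ h2 hdisc ψ t hqt h4t => ?_⟩
  by_cases h1 : ψ = 1
  · subst h1
    have hre : (1 / 2 + t * I : ℂ).re = 1 / 2 := by simp
    have him : (1 / 2 + t * I : ℂ).im = t := by simp
    exact h q hq K h2 hdisc _ (by rw [hre]; norm_num) (by rw [hre]; norm_num) (by rwa [him])
      (by rwa [him])
  · rw [afeR_of_ne_one h1, norm_zero]; exact hM.le

/-! ### The discrete mean square of `L(½+it,ψ)` -/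

/-- **THE DISCRETE MEAN SQUARE OF `L(½+it,ψ)` OVER A DYADIC POINT SET, FROM PROPOSITION 6.4.**
For `q` odd `> 4`, `K = ℚ(√−q)`, `ψ ∈ Ĉℓ(K)`, `1`-spaced `S ⊂ (T, 2T]`, `q^66 ≤ T`, `e^{(log q)²} ≤ T`:
`Σ_{t∈S} |L(½+it,ψ)|² ≤ C·(T(log q)^7 + Tℒ(T)(log T)^4)` with an absolute `C` — the printed
"`Σ_s|A₃(s)|² ≪ T(log q)^5 + Tℒ(T)(log T)² + Tℒ(T)(log q)²`" (p. 19) transported to `L` by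
(7.12), here from `main_meanSquares` (ii), `sum_norm_shortLSum_sq_le` and `norm_afeR_half_le`.
[cite: ConreyIwaniec2002, §8 (8.7)–(8.10); Proposition 7.1 (7.12)] -/
theorem sum_norm_classGroupLFunction_sq_le (h64 : conreyIwaniec2002_proposition64) :
    ∃ C : ℝ, 0 < C ∧
    ∀ (q : ℕ) [NeZero q], 4 < q → Odd q → ∀ χ : DirichletCharacter ℂ q,
      χ.IsPrimitive → χ.IsQuadratic → χ.Odd →
        ∀ (K : Type) [Field K] [NumberField K],
          Module.finrank ℚ K = 2 → NumberField.discr K = -(q : ℤ) →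
            ∀ (ψ : ClassGroup (𝓞 K) →* ℂˣ) (T : ℝ) (S : Finset ℝ),
              (q : ℝ) ^ (66 : ℕ) ≤ T → Real.exp (Real.log q ^ (2 : ℕ)) ≤ T → IsDyadicPointSet S T →
                ∑ t ∈ S, ‖classGroupLFunction K ψ (1 / 2 + t * I)‖ ^ 2 ≤
                  C * (T * Real.log q ^ (7 : ℕ) + T * calL χ T * Real.log T ^ (4 : ℕ)) := by
  obtain ⟨C₁, hC₁, hMS⟩ := main_meanSquares h64 divisorSq_weighted_tsum_le
  obtain ⟨C₂, hC₂, hN⟩ := sum_norm_shortLSum_sq_le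
  obtain ⟨M, hM, hR⟩ := norm_afeR_half_le
  refine ⟨12 * C₁ + 12 * C₂ + 6 * M ^ 2, by positivity,
    fun q _ hq hodd χ hprim hquad hoddχ K _ _ h2 hdisc ψ T S hT hexpT hS => ?_⟩
  have hq0 : 0 < q := by omega
  obtain ⟨hℓ1, -, hLT1, -, hq41, -, hT3, -, -, -, -, hq_le_T⟩ := prop81_numerics hq hT hexpT
  have hT0 : 0 < T := by linarith
  have hq4T : (q : ℝ) ^ (4 : ℕ) ≤ T := by
    have : ((q ^ 4 : ℕ) : ℝ) = (q : ℝ) ^ (4 : ℕ) := by push_cast; ring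
    linarith
  have hcalL0 : 0 ≤ calL χ T := calL_nonneg χ (by linarith)
  set X : ℝ := T * Real.log q ^ (7 : ℕ) + T * calL χ T * Real.log T ^ (4 : ℕ) with hX
  -- (ii) of `main_meanSquares` with the dummy companions `t ↦ t + 1/2`
  have hii := (hMS q hq hodd χ hprim hquad hoddχ K h2 hdisc ψ T S (fun t => t + 1 / 2) hT hexpT hS
    (fun t _ => ⟨by linarith, by
      rw [show t + 1 / 2 - t = (1 / 2 : ℝ) by ring, abs_of_pos (by norm_num)]; norm_num⟩)).2
  have hAN : ∑ t ∈ S, ‖afeA K ψ q (1 / 2 + t * I) - shortLSum K ψ q (1 / 2 + t * I)‖ ^ 2 ≤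
      C₁ * X := by
    have h0 : 0 ≤ ∑ t ∈ S, ‖afeA K ψ q (1 / 2 + t * I) - shortLSum K ψ q (1 / 2 + t * I)‖ ^ 2 :=
      Finset.sum_nonneg fun _ _ => by positivity
    have h1 : (1 : ℝ) ≤ Real.log T ^ (2 : ℕ) := one_le_pow₀ hLT1
    calc ∑ t ∈ S, ‖afeA K ψ q (1 / 2 + t * I) - shortLSum K ψ q (1 / 2 + t * I)‖ ^ 2
        = 1 * ∑ t ∈ S, ‖afeA K ψ q (1 / 2 + t * I) - shortLSum K ψ q (1 / 2 + t * I)‖ ^ 2 :=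
          (one_mul _).symm
      _ ≤ Real.log T ^ (2 : ℕ) *
            ∑ t ∈ S, ‖afeA K ψ q (1 / 2 + t * I) - shortLSum K ψ q (1 / 2 + t * I)‖ ^ 2 :=
          mul_le_mul_of_nonneg_right h1 h0
      _ ≤ C₁ * X := hii
  -- the mean square of `N`
  have hNN := hN q hq hodd χ hprim hquad hoddχ K h2 hdisc ψ T S hq4T hS
  -- pointwise `|L|² ≤ 12|A − N|² + 12|N|² + 3M²`
  have hpt : ∀ t ∈ S, ‖classGroupLFunction K ψ (1 / 2 + t * I)‖ ^ 2 ≤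
      12 * ‖afeA K ψ q (1 / 2 + t * I) - shortLSum K ψ q (1 / 2 + t * I)‖ ^ 2 +
        12 * ‖shortLSum K ψ q (1 / 2 + t * I)‖ ^ 2 + 3 * M ^ 2 := by
    intro t ht
    obtain ⟨hTt, -⟩ := hS.mem_bounds ht
    have hq5 : (5 : ℝ) ≤ q := by exact_mod_cast hq
    have h625 : (5 : ℝ) ^ (4 : ℕ) ≤ (q : ℝ) ^ (4 : ℕ) := pow_le_pow_left₀ (by norm_num) hq5 4
    have ht4 : 4 ≤ |t| := by rw [abs_of_pos (by linarith)]; norm_num at h625; linarith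
    have htq : (q : ℝ) + 1 ≤ |t| := by
      rw [abs_of_pos (by linarith)]
      have : (q : ℝ) ≤ (q : ℝ) ^ (4 : ℕ) := le_self_pow₀ (by
        have : (5 : ℝ) ≤ q := by exact_mod_cast hq
        linarith) (by norm_num)
      have h' : ((q ^ 4 : ℕ) : ℝ) = (q : ℝ) ^ (4 : ℕ) := by push_cast; ring
      linarith
    have hL := norm_classGroupLFunction_le_afe hq0 K h2 hdisc ψ t
    have hRt := hR q hq0 K h2 hdisc ψ t htq ht4
    set A := afeA K ψ q (1 / 2 + t * I) with hA
    set Nn := shortLSum K ψ q (1 / 2 + t * I) with hNn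
    have hAle : ‖A‖ ≤ ‖A - Nn‖ + ‖Nn‖ := by
      calc ‖A‖ = ‖(A - Nn) + Nn‖ := by rw [sub_add_cancel]
        _ ≤ ‖A - Nn‖ + ‖Nn‖ := norm_add_le _ _
    have hLle : ‖classGroupLFunction K ψ (1 / 2 + t * I)‖ ≤ 2 * ‖A - Nn‖ + 2 * ‖Nn‖ + M := by
      linarith
    have h0 : 0 ≤ ‖classGroupLFunction K ψ (1 / 2 + t * I)‖ := norm_nonneg _
    have h1 : 0 ≤ ‖A - Nn‖ := norm_nonneg _
    have h2' : 0 ≤ ‖Nn‖ := norm_nonneg _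
    calc ‖classGroupLFunction K ψ (1 / 2 + t * I)‖ ^ 2 ≤ (2 * ‖A - Nn‖ + 2 * ‖Nn‖ + M) ^ 2 :=
          pow_le_pow_left₀ h0 hLle 2
      _ ≤ 12 * ‖A - Nn‖ ^ 2 + 12 * ‖Nn‖ ^ 2 + 3 * M ^ 2 := by
          nlinarith [sq_nonneg (‖A - Nn‖ - ‖Nn‖), sq_nonneg (2 * ‖Nn‖ - M),
            sq_nonneg (2 * ‖A - Nn‖ - M)]
  -- the number of points
  have hT2 : (2 : ℝ) ≤ T := by linarith
  have hcard : (S.card : ℝ) ≤ 2 * T := (hS.isPointSet hT2).card_le' (by linarith)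
  -- lower-order terms against `X`
  have hX1 : T * Real.log q ^ (5 : ℕ) ≤ X := by
    have h57 : Real.log q ^ (5 : ℕ) ≤ Real.log q ^ (7 : ℕ) := pow_le_pow_right₀ hℓ1 (by norm_num)
    have : 0 ≤ T * calL χ T * Real.log T ^ (4 : ℕ) := by positivity
    rw [hX]; nlinarith
  have hX2 : T ≤ X := by
    have h7 : (1 : ℝ) ≤ Real.log q ^ (7 : ℕ) := one_le_pow₀ hℓ1
    have : 0 ≤ T * calL χ T * Real.log T ^ (4 : ℕ) := by positivity
    rw [hX]; nlinarith
  calc ∑ t ∈ S, ‖classGroupLFunction K ψ (1 / 2 + t * I)‖ ^ 2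
      ≤ ∑ t ∈ S, (12 * ‖afeA K ψ q (1 / 2 + t * I) - shortLSum K ψ q (1 / 2 + t * I)‖ ^ 2 +
          12 * ‖shortLSum K ψ q (1 / 2 + t * I)‖ ^ 2 + 3 * M ^ 2) := Finset.sum_le_sum hpt
    _ = 12 * ∑ t ∈ S, ‖afeA K ψ q (1 / 2 + t * I) - shortLSum K ψ q (1 / 2 + t * I)‖ ^ 2 +
          12 * ∑ t ∈ S, ‖shortLSum K ψ q (1 / 2 + t * I)‖ ^ 2 + 3 * M ^ 2 * S.card := by
        rw [Finset.sum_add_distrib, Finset.sum_add_distrib, Finset.sum_const, nsmul_eq_mul,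
          ← Finset.mul_sum, ← Finset.mul_sum]
        ring
    _ ≤ 12 * (C₁ * X) + 12 * (C₂ * (T * Real.log q ^ (5 : ℕ))) + 3 * M ^ 2 * (2 * T) := by
        gcongr
    _ ≤ 12 * (C₁ * X) + 12 * (C₂ * X) + 3 * M ^ 2 * (2 * X) := by
        have hM2 : 0 ≤ 3 * M ^ 2 := by positivity
        nlinarith [mul_le_mul_of_nonneg_left hX1 hC₂.le, mul_le_mul_of_nonneg_left hX2 hM2]
    _ = (12 * C₁ + 12 * C₂ + 6 * M ^ 2) * X := by ring

end ConreyIwaniec2002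

end Literature.NumberTheory.LFunctions

end
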